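/-
Copyright (c) 2026 the pub-hodgecm-mathlib formalisation cell (harness21).  Prover seat hodgecm-mathlib-K2E4-p10 (g7), Track B ∕ K2-LIT, h413 = `stmt-HodgeConjecture-24833`,
line `K2_E1_TraceFormulaBeta`, 5Res ROADCARD «ENDGAME BY FAMILIES» §3′ M2 v2 (K2E1-plan (g7), (204)∕(207)∕(232)) file D4′c (SD) part 2: the VECTOR contour-shift adapter — ★ T4b-multi
`K2E1PseudoEisensteinContourShiftMultiCMTwo` applied entrywise to a finite sum of pure tensors and reassembled into the `hIP` letter of ★ `K2E1PseudoEisensteinPlancherelIsometryOperator`.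
-/
import Summits.HodgeConjecture.HodgeConjecture.Theorems.K2E1PseudoEisensteinContourShiftMultiCMTwo   -- ★ T4b-multi p859979 (K2E4-p11): `integral_innerProductIntegrand_eq_add_sum_residues`, `integrable_innerProductIntegrand_vertical_of_finset`; brings ★ C4-multi, ★ T4b, ★ A
import Mathlib.Analysis.InnerProductSpace.Basic
import HarnessLib

/-!
# D4′c (SD) part 2 — `K2E1PseudoEisensteinContourShiftVector`: the two-term inner-product integrand of a SELF-DUAL family with VECTOR transforms and an OPERATOR intertwining datum,
# moved from `Re z = σ₀` to the unitary axis across finitely many simple real poles — entrywise ★ T4b-multi + Finset reassembly (pure analysis + linear algebra)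

Track B ∕ K2-LIT, crux h413 = `stmt-HodgeConjecture-24833`, route of record `HCCMUnconditional`; cell `hodgecm-mathlib`, squad K2, ENGINE E1.  THEOREMS ONLY (no `def`, no `instance`,
no `notation`, no named-fact hypothesis, no `sorry`; default heartbeats); lane `--supports stmt-HodgeConjecture-24833 --as helper` (count-neutral).  No automorphic object.
THE MATHEMATICS ([MoeglinWaldspurger1995, II.2.1–II.2.4, IV.1.11]; [Titchmarsh1939, §3.12]).  At a `K`-type `(K′, ω)` with `dim V(χ, K′, ω) > 1` a section field of a self-dual `χ`-family is a
finite sum of pure tensors `Ψ = Σ_a f_a ⊗ φ_a`, its transform `Ψ̂(w) = Σ_a f̃_a(w)·φ_a ∈ V` is VECTOR-valued and the intertwining datum `M(z) ∈ End V` is OPERATOR-valued; the two-term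
inner-product integrand on the line `Re z = σ₀` is the SCALAR function `F(z) = ⟪Ψ̂′(−(1−z̄)), Ψ̂(−z)⟫_V + ⟪Ψ̂′(−z̄), M(z)Ψ̂(−z)⟫_V` — the sum over entries `(a,b)` of
`F_{ab}(z) = f̃_a(−z)·(g_{ab}·conj f̃′_b(−(1−z̄)) + s_{ab}(z)·conj f̃′_b(−z̄))` with the CONSTANT `g_{ab} = ⟪φ′_b, φ_a⟫` and the scalar meromorphic entry `s_{ab}(z) = ⟪φ′_b, M(z)φ_a⟫`
(§3, sesquilinearity).  ★ T4b-multi shifts `F_{ab}` with `g_{ab} = 1`; a constant first-term coefficient is handled by LINEARITY (`F_g = g·F_0 + (F_s − F_0)`, the first term being ENTIRE, §1);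
summing over `(a,b)` (§2) and reassembling the residues `Σ_{ab} Res_c s_{ab}·f̃_a(−c)·conj f̃′_b(−c) = ⟪Ψ̂′(−c), R_c Ψ̂(−c)⟫` (`⟪φ′_b, R_c φ_a⟫ = Res_c s_{ab}`, §3) gives (§4 HEAD)
**`IP = C·(Σ_{c∈S} ⟪Ψ̂′(−c), R_c Ψ̂(−c)⟫) + C·((2π)⁻¹·∫_ℝ F(½+iy) dy)`** from `hIP : IP = C·((2π)⁻¹·∫_ℝ F(σ₀+iy) dy)` — LITERALLY the hypothesis `hIP` of ★
`K2E1PseudoEisensteinPlancherelIsometryOperator.plancherelForm_of_innerProductFormula_op` at `(Φ, Ψ, s, D, k) := (Ψ̂, Ψ̂′, M, C·Σ_c ⟪Ψ̂′(−c), R_c Ψ̂(−c)⟫, (2π)⁻¹)`.  Letters per entry =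
★ T4b-multi's: `hs` (holomorphy of `z ↦ ⟪φ′_b, M(z)φ_a⟫` on an open `U ⊇ {½ ≤ Re z ≤ σ₀}` off a finset `S ⊂ (½, σ₀)` of real poles), `hr` (`(z − c)·⟪φ′_b, M(z)φ_a⟫ → ⟪φ′_b, R_c φ_a⟫`),
`hB` (strip bound at `|Im z| ≥ 1`) — the (b)-block's matrix Maass–Selberg currency at `(K′, ω)` through the `L²(K_U)`-pairing of sections.
* §1 `integrable_innerProductIntegrand_const_vertical_of_finset`, **`integral_innerProductIntegrand_const_eq_add_sum_residues`** (★ T4b-multi with a first-term constant `g`).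
* §2 `sum_sum_integral_innerProductIntegrand_const_eq` (entrywise shift summed over a finite index pair).
* §3 `inner_sum_smul_sum_smul` (sesquilinear expansion), `vectorIntegrand_eq_sum_sum`, `vectorResidue_eq_sum_sum`.
* §4 HEAD **`pseudoEisenstein_contourShift_vector_of_letters`** + `integrable_vectorIntegrand_vertical` (the axis integrand is `L¹`, = HEAD-op's `hG` after ★ `axis_integrand_eq_op`).
HONEST LABEL: HC_CM is proved only modulo the 7 printed citations (2 remaining named inputs: hLiu418 = `stmt-HodgeConjecture-24832`, h413 = `stmt-HodgeConjecture-24833`) until rung 0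
closes; this file asserts no named fact, closes no socket; count-neutral; letters `hs∕hr∕hB` per entry (matrix MS at the `K`-type) and `hIP` (H-χ (SD) two-term formula in vector currency).

## References
* [MoeglinWaldspurger1995] C. Mœglin, J.-L. Waldspurger, *Spectral decomposition and Eisenstein series* (1995), II.2.1–II.2.4, IV.1.11.
* [Titchmarsh1939] E. C. Titchmarsh, *The Theory of Functions* (2nd ed., 1939), §3.1, §3.12.
-/

set_option autoImplicit false
set_option linter.dupNamespace false  -- the mandated namespace repeats the summit's segment (`HodgeConjecture.HodgeConjecture`)

noncomputable section

open MeasureTheory Measure Set Filter Topology Complex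
open scoped Real ComplexConjugate InnerProductSpace BigOperators
open Summit.HodgeConjecture.HodgeConjecture.Cruxes.H413.K2E1PseudoEisensteinContourShiftMultiCMTwo (integral_innerProductIntegrand_eq_add_sum_residues
  integrable_innerProductIntegrand_vertical_of_finset)

namespace Summit.HodgeConjecture.HodgeConjecture.Cruxes.H413.K2E1PseudoEisensteinContourShiftVector

/-! ## §1 ★ T4b-multi with a constant first-term coefficient `g` (linearity; the first term is entire) -/

section Const

variable {f f' : ℝ → ℂ} {s : ℂ → ℂ} {U : Set ℂ} {σ₀ B : ℝ} {S : Finset ℝ}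

/-- `y ↦ F_g(σ+iy)` is integrable for `σ ∈ [½, σ₀]` off the poles, `F_g(z) = f̃(−z)·(g·conj f̃′(−(1−z̄)) + s(z)·conj f̃′(−z̄))` (`F_g = g·F_0 + (F_s − F_0)`, ★ T4b-multi at `s` and at `0`).
[cite: MoeglinWaldspurger1995, II.2.2] -/
theorem integrable_innerProductIntegrand_const_vertical_of_finset (hf : ContDiff ℝ 2 f) (hfs : HasCompactSupport f) (hf0 : tsupport f ⊆ Ioi 0)
    (hf' : ContDiff ℝ 2 f') (hf's : HasCompactSupport f') (hf'0 : tsupport f' ⊆ Ioi 0) (hσ₀ : 1 / 2 < σ₀)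
    (hUo : IsOpen U) (hUs : {z : ℂ | 1 / 2 ≤ z.re ∧ z.re ≤ σ₀} ⊆ U) (hs : DifferentiableOn ℂ s (U \ ((S.image fun c : ℝ => (c : ℂ)) : Set ℂ))) (hS : ∀ c ∈ S, 1 / 2 < c)
    (hB : ∀ z : ℂ, 1 / 2 < z.re → z.re ≤ σ₀ → 1 ≤ |z.im| → ‖s z‖ ≤ B) (g : ℂ) {σ : ℝ} (hσ₁ : 1 / 2 ≤ σ) (hσ₂ : σ ≤ σ₀) (hσ : ∀ c ∈ S, σ ≠ c) :
    Integrable fun y : ℝ => mellin f (-((σ : ℂ) + y * I)) * (g * conj (mellin f' (-(1 - conj ((σ : ℂ) + y * I)))) + s ((σ : ℂ) + y * I) * conj (mellin f' (-conj ((σ : ℂ) + y * I)))) := by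
  have hFs := integrable_innerProductIntegrand_vertical_of_finset hf hfs hf0 hf' hf's hf'0 hσ₀ hUo hUs hs hS hB hσ₁ hσ₂ hσ
  have hF0 := integrable_innerProductIntegrand_vertical_of_finset (s := fun _ => (0 : ℂ)) (S := (∅ : Finset ℝ)) (B := 0) hf hfs hf0 hf' hf's hf'0 hσ₀ isOpen_univ (subset_univ _)
    (differentiableOn_const (0 : ℂ)) (by simp) (fun _ _ _ _ => by simp) hσ₁ hσ₂ (by simp)
  refine ((hF0.const_mul g).add (hFs.sub hF0)).congr (Eventually.of_forall fun y => ?_)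
  simp only [Pi.add_apply, Pi.sub_apply]
  ring

/-- **★ T4b-multi WITH A CONSTANT FIRST-TERM COEFFICIENT**: for `F_g(z) = f̃(−z)·(g·conj f̃′(−(1−z̄)) + s(z)·conj f̃′(−z̄))`,
`∫_ℝ F_g(σ₀+iy) dy = ∫_ℝ F_g(½+iy) dy + 2π·Σ_{c∈S} r_c·f̃(−c)·conj f̃′(−c)` — same letters as ★ T4b-multi (`g = 1`); the first term is entire and shifts with no residue.
[cite: MoeglinWaldspurger1995, II.2.4] [cite: Titchmarsh1939, §3.12] -/
theorem integral_innerProductIntegrand_const_eq_add_sum_residues (hf : ContDiff ℝ 2 f) (hfs : HasCompactSupport f) (hf0 : tsupport f ⊆ Ioi 0)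
    (hf' : ContDiff ℝ 2 f') (hf's : HasCompactSupport f') (hf'0 : tsupport f' ⊆ Ioi 0) (hσ₀ : 1 / 2 < σ₀)
    (hUo : IsOpen U) (hUs : {z : ℂ | 1 / 2 ≤ z.re ∧ z.re ≤ σ₀} ⊆ U) (hs : DifferentiableOn ℂ s (U \ ((S.image fun c : ℝ => (c : ℂ)) : Set ℂ)))
    (hS : ∀ c ∈ S, 1 / 2 < c ∧ c < σ₀) (r : ℝ → ℂ) (hr : ∀ c ∈ S, Tendsto (fun z : ℂ => (z - c) * s z) (𝓝[≠] (c : ℂ)) (𝓝 (r c)))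
    (hB : ∀ z : ℂ, 1 / 2 < z.re → z.re ≤ σ₀ → 1 ≤ |z.im| → ‖s z‖ ≤ B) (g : ℂ) :
    ∫ y : ℝ, mellin f (-((σ₀ : ℂ) + y * I)) * (g * conj (mellin f' (-(1 - conj ((σ₀ : ℂ) + y * I)))) + s ((σ₀ : ℂ) + y * I) * conj (mellin f' (-conj ((σ₀ : ℂ) + y * I)))) =
      (∫ y : ℝ, mellin f (-((((1 / 2 : ℝ)) : ℂ) + y * I)) *
          (g * conj (mellin f' (-(1 - conj ((((1 / 2 : ℝ)) : ℂ) + y * I)))) + s ((((1 / 2 : ℝ)) : ℂ) + y * I) * conj (mellin f' (-conj ((((1 / 2 : ℝ)) : ℂ) + y * I))))) +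
        2 * π * ∑ c ∈ S, r c * (mellin f (-(c : ℂ)) * conj (mellin f' (-(c : ℂ)))) := by
  have hS' : ∀ c ∈ S, 1 / 2 < c := fun c hc => (hS c hc).1
  -- ★ T4b-multi for `F_s` (poles `S`) and for `F_0` (no pole)
  have hshift := integral_innerProductIntegrand_eq_add_sum_residues hf hfs hf0 hf' hf's hf'0 hσ₀ hUo hUs hs hS hr hB
  have hshift0 := integral_innerProductIntegrand_eq_add_sum_residues (s := fun _ => (0 : ℂ)) (S := (∅ : Finset ℝ)) (r := fun _ => 0) (B := 0) hf hfs hf0 hf' hf's hf'0 hσ₀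
    isOpen_univ (subset_univ _) (differentiableOn_const (0 : ℂ)) (by simp) (by simp) (fun _ _ _ _ => by simp)
  -- integrability on the two lines
  have iFs₂ := integrable_innerProductIntegrand_vertical_of_finset hf hfs hf0 hf' hf's hf'0 hσ₀ hUo hUs hs hS' hB hσ₀.le le_rfl (fun c hc => (hS c hc).2.ne')
  have iFs₁ := integrable_innerProductIntegrand_vertical_of_finset hf hfs hf0 hf' hf's hf'0 hσ₀ hUo hUs hs hS' hB le_rfl hσ₀.le (fun c hc => (hS c hc).1.ne)
  have iF0₂ := integrable_innerProductIntegrand_vertical_of_finset (s := fun _ => (0 : ℂ)) (S := (∅ : Finset ℝ)) (B := 0) hf hfs hf0 hf' hf's hf'0 hσ₀ isOpen_univ (subset_univ _)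
    (differentiableOn_const (0 : ℂ)) (by simp) (fun _ _ _ _ => by simp) hσ₀.le le_rfl (by simp)
  have iF0₁ := integrable_innerProductIntegrand_vertical_of_finset (s := fun _ => (0 : ℂ)) (S := (∅ : Finset ℝ)) (B := 0) hf hfs hf0 hf' hf's hf'0 hσ₀ isOpen_univ (subset_univ _)
    (differentiableOn_const (0 : ℂ)) (by simp) (fun _ _ _ _ => by simp) (le_refl (1 / 2 : ℝ)) hσ₀.le (by simp)
  -- `F_g = g·F_0 + (F_s − F_0)` on every line
  have hdec : ∀ σ : ℝ, (fun y : ℝ => mellin f (-((σ : ℂ) + y * I)) * (g * conj (mellin f' (-(1 - conj ((σ : ℂ) + y * I)))) + s ((σ : ℂ) + y * I) * conj (mellin f' (-conj ((σ : ℂ) + y * I))))) =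
      fun y : ℝ => g * (mellin f (-((σ : ℂ) + y * I)) * (conj (mellin f' (-(1 - conj ((σ : ℂ) + y * I)))) + 0 * conj (mellin f' (-conj ((σ : ℂ) + y * I))))) +
        (mellin f (-((σ : ℂ) + y * I)) * (conj (mellin f' (-(1 - conj ((σ : ℂ) + y * I)))) + s ((σ : ℂ) + y * I) * conj (mellin f' (-conj ((σ : ℂ) + y * I)))) -
          mellin f (-((σ : ℂ) + y * I)) * (conj (mellin f' (-(1 - conj ((σ : ℂ) + y * I)))) + 0 * conj (mellin f' (-conj ((σ : ℂ) + y * I))))) := fun σ => by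
    funext y; ring
  rw [hdec σ₀, hdec (1 / 2), integral_add (iF0₂.const_mul g) (iFs₂.sub' iF0₂), integral_add (iF0₁.const_mul g) (iFs₁.sub' iF0₁), integral_sub iFs₂ iF0₂, integral_sub iFs₁ iF0₁,
    integral_const_mul, integral_const_mul, hshift, hshift0]
  simp only [Finset.sum_empty, mul_zero, add_zero]
  ring

end Const

/-! ## §2 Entrywise shift summed over a finite index pair -/

section Sum

variable {α β : Type*} [Fintype α] [Fintype β]

/-- `Σ_a Σ_b x·Σ_{c∈S} R_{ab}(c) = x·Σ_{c∈S} Σ_a Σ_b R_{ab}(c)` (finite sums commute; constants pull out). [folklore] -/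
theorem sum_sum_mul_sum_comm {γ : Type*} (x : ℂ) (S : Finset γ) (R : α → β → γ → ℂ) :
    ∑ a, ∑ b, x * ∑ c ∈ S, R a b c = x * ∑ c ∈ S, ∑ a, ∑ b, R a b c := by
  simp only [Finset.mul_sum]
  rw [Finset.sum_comm (s := S) (t := (Finset.univ : Finset α))]
  refine Finset.sum_congr rfl fun a _ => ?_
  exact Finset.sum_comm

/-- **ENTRYWISE ★ T4b-multi SUMMED OVER `(a, b) ∈ α × β`** (finite): with a COMMON open `U ⊇ {½ ≤ Re z ≤ σ₀}` and finset `S ⊂ (½, σ₀)` of candidate poles,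
`Σ_{a,b} ∫_ℝ F_{ab}(σ₀+iy) dy = Σ_{a,b} ∫_ℝ F_{ab}(½+iy) dy + 2π·Σ_{c∈S} Σ_{a,b} r_{ab}(c)·f̃_a(−c)·conj f̃′_b(−c)`. [cite: MoeglinWaldspurger1995, II.2.4] -/
theorem sum_sum_integral_innerProductIntegrand_const_eq {f : α → ℝ → ℂ} {f' : β → ℝ → ℂ}
    (hf : ∀ a, ContDiff ℝ 2 (f a)) (hfs : ∀ a, HasCompactSupport (f a)) (hf0 : ∀ a, tsupport (f a) ⊆ Ioi 0)
    (hf' : ∀ b, ContDiff ℝ 2 (f' b)) (hf's : ∀ b, HasCompactSupport (f' b)) (hf'0 : ∀ b, tsupport (f' b) ⊆ Ioi 0) {σ₀ : ℝ} (hσ₀ : 1 / 2 < σ₀)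
    {U : Set ℂ} (hUo : IsOpen U) (hUs : {z : ℂ | 1 / 2 ≤ z.re ∧ z.re ≤ σ₀} ⊆ U) (S : Finset ℝ) (hS : ∀ c ∈ S, 1 / 2 < c ∧ c < σ₀)
    (g : α → β → ℂ) (s : α → β → ℂ → ℂ) (hs : ∀ a b, DifferentiableOn ℂ (s a b) (U \ ((S.image fun c : ℝ => (c : ℂ)) : Set ℂ)))
    (r : α → β → ℝ → ℂ) (hr : ∀ a b, ∀ c ∈ S, Tendsto (fun z : ℂ => (z - c) * s a b z) (𝓝[≠] (c : ℂ)) (𝓝 (r a b c)))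
    {B : ℝ} (hB : ∀ a b, ∀ z : ℂ, 1 / 2 < z.re → z.re ≤ σ₀ → 1 ≤ |z.im| → ‖s a b z‖ ≤ B) :
    ∑ a, ∑ b, ∫ y : ℝ, mellin (f a) (-((σ₀ : ℂ) + y * I)) *
        (g a b * conj (mellin (f' b) (-(1 - conj ((σ₀ : ℂ) + y * I)))) + s a b ((σ₀ : ℂ) + y * I) * conj (mellin (f' b) (-conj ((σ₀ : ℂ) + y * I)))) =
      (∑ a, ∑ b, ∫ y : ℝ, mellin (f a) (-((((1 / 2 : ℝ)) : ℂ) + y * I)) *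
          (g a b * conj (mellin (f' b) (-(1 - conj ((((1 / 2 : ℝ)) : ℂ) + y * I)))) + s a b ((((1 / 2 : ℝ)) : ℂ) + y * I) * conj (mellin (f' b) (-conj ((((1 / 2 : ℝ)) : ℂ) + y * I))))) +
        2 * π * ∑ c ∈ S, ∑ a, ∑ b, r a b c * (mellin (f a) (-(c : ℂ)) * conj (mellin (f' b) (-(c : ℂ)))) := by
  have h : ∀ a b, ∫ y : ℝ, mellin (f a) (-((σ₀ : ℂ) + y * I)) *
        (g a b * conj (mellin (f' b) (-(1 - conj ((σ₀ : ℂ) + y * I)))) + s a b ((σ₀ : ℂ) + y * I) * conj (mellin (f' b) (-conj ((σ₀ : ℂ) + y * I)))) =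
      (∫ y : ℝ, mellin (f a) (-((((1 / 2 : ℝ)) : ℂ) + y * I)) *
          (g a b * conj (mellin (f' b) (-(1 - conj ((((1 / 2 : ℝ)) : ℂ) + y * I)))) + s a b ((((1 / 2 : ℝ)) : ℂ) + y * I) * conj (mellin (f' b) (-conj ((((1 / 2 : ℝ)) : ℂ) + y * I))))) +
        2 * π * ∑ c ∈ S, r a b c * (mellin (f a) (-(c : ℂ)) * conj (mellin (f' b) (-(c : ℂ)))) := fun a b =>
    integral_innerProductIntegrand_const_eq_add_sum_residues (hf a) (hfs a) (hf0 a) (hf' b) (hf's b) (hf'0 b) hσ₀ hUo hUs (hs a b) hS (r a b) (hr a b) (hB a b) (g a b)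
  rw [Finset.sum_congr rfl fun a _ => Finset.sum_congr rfl fun b _ => h a b]
  simp only [Finset.sum_add_distrib]
  rw [sum_sum_mul_sum_comm]

end Sum

/-! ## §3 Sesquilinear expansion: the vector integrand and the vector residue as sums over entries -/

section Vector

variable {V : Type*} [NormedAddCommGroup V] [InnerProductSpace ℂ V] {α β : Type*} [Fintype α] [Fintype β]

/-- `⟪Σ_b c_b•φ′_b, T(Σ_a d_a•φ_a)⟫ = Σ_a Σ_b d_a·(⟪φ′_b, T φ_a⟫·conj c_b)` for a `ℂ`-linear `T` (sesquilinearity; Mathlib `sum_inner`, `inner_sum`, `map_sum`). [folklore] -/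
theorem inner_sum_smul_sum_smul (T : V →ₗ[ℂ] V) (c : β → ℂ) (d : α → ℂ) (φ : α → V) (φ' : β → V) :
    ⟪∑ b, c b • φ' b, T (∑ a, d a • φ a)⟫_ℂ = ∑ a, ∑ b, d a * (⟪φ' b, T (φ a)⟫_ℂ * conj (c b)) := by
  rw [_root_.map_sum, sum_inner, Finset.sum_comm]
  refine Finset.sum_congr rfl fun b _ => ?_
  rw [inner_sum]
  refine Finset.sum_congr rfl fun a _ => ?_
  rw [map_smul, inner_smul_left, inner_smul_right]
  ring

/-- **THE VECTOR INTEGRAND IS THE SUM OF ITS ENTRIES**: with `Ψ̂(w) = Σ_a f̃_a(w)•φ_a`, `Ψ̂′(w) = Σ_b f̃′_b(w)•φ′_b`,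
`⟪Ψ̂′(−(1−z̄)), Ψ̂(−z)⟫ + ⟪Ψ̂′(−z̄), M(z)Ψ̂(−z)⟫ = Σ_{a,b} f̃_a(−z)·(⟪φ′_b, φ_a⟫·conj f̃′_b(−(1−z̄)) + ⟪φ′_b, M(z)φ_a⟫·conj f̃′_b(−z̄))`. [cite: MoeglinWaldspurger1995, II.2.1] -/
theorem vectorIntegrand_eq_sum_sum (f : α → ℝ → ℂ) (f' : β → ℝ → ℂ) (φ : α → V) (φ' : β → V) (M : ℂ → V →ₗ[ℂ] V) (z : ℂ) :
    ⟪∑ b, mellin (f' b) (-(1 - conj z)) • φ' b, ∑ a, mellin (f a) (-z) • φ a⟫_ℂ + ⟪∑ b, mellin (f' b) (-conj z) • φ' b, M z (∑ a, mellin (f a) (-z) • φ a)⟫_ℂ =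
      ∑ a, ∑ b, mellin (f a) (-z) * (⟪φ' b, φ a⟫_ℂ * conj (mellin (f' b) (-(1 - conj z))) + ⟪φ' b, M z (φ a)⟫_ℂ * conj (mellin (f' b) (-conj z))) := by
  have h1 := inner_sum_smul_sum_smul (LinearMap.id : V →ₗ[ℂ] V) (fun b => mellin (f' b) (-(1 - conj z))) (fun a => mellin (f a) (-z)) φ φ'
  have h2 := inner_sum_smul_sum_smul (M z) (fun b => mellin (f' b) (-conj z)) (fun a => mellin (f a) (-z)) φ φ'
  simp only [LinearMap.id_apply] at h1
  rw [h1, h2, ← Finset.sum_add_distrib]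
  refine Finset.sum_congr rfl fun a _ => ?_
  rw [← Finset.sum_add_distrib]
  refine Finset.sum_congr rfl fun b _ => ?_
  ring

/-- **THE VECTOR RESIDUE IS THE SUM OF ITS ENTRIES**: `⟪Ψ̂′(−c), R_c Ψ̂(−c)⟫ = Σ_{a,b} ⟪φ′_b, R_c φ_a⟫·(f̃_a(−c)·conj f̃′_b(−c))`. [cite: MoeglinWaldspurger1995, II.2.4] -/
theorem vectorResidue_eq_sum_sum (f : α → ℝ → ℂ) (f' : β → ℝ → ℂ) (φ : α → V) (φ' : β → V) (R : V →ₗ[ℂ] V) (w : ℂ) :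
    ⟪∑ b, mellin (f' b) w • φ' b, R (∑ a, mellin (f a) w • φ a)⟫_ℂ = ∑ a, ∑ b, ⟪φ' b, R (φ a)⟫_ℂ * (mellin (f a) w * conj (mellin (f' b) w)) := by
  rw [inner_sum_smul_sum_smul]
  refine Finset.sum_congr rfl fun a _ => Finset.sum_congr rfl fun b _ => ?_
  ring

/-! ## §4 HEAD: the vector two-term formula moved to the unitary axis (★ HEAD-op's `hIP`) -/

/-- **THE AXIS INTEGRAND IS `L¹` ON EVERY LINE OFF THE POLES** (`σ ∈ [½, σ₀]`, `σ ∉ S`): a finite sum of the integrable entries (§1). [cite: MoeglinWaldspurger1995, II.2.2] -/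
theorem integrable_vectorIntegrand_vertical {f : α → ℝ → ℂ} {f' : β → ℝ → ℂ}
    (hf : ∀ a, ContDiff ℝ 2 (f a)) (hfs : ∀ a, HasCompactSupport (f a)) (hf0 : ∀ a, tsupport (f a) ⊆ Ioi 0)
    (hf' : ∀ b, ContDiff ℝ 2 (f' b)) (hf's : ∀ b, HasCompactSupport (f' b)) (hf'0 : ∀ b, tsupport (f' b) ⊆ Ioi 0) {σ₀ : ℝ} (hσ₀ : 1 / 2 < σ₀)
    (φ : α → V) (φ' : β → V) (M : ℂ → V →ₗ[ℂ] V)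
    {U : Set ℂ} (hUo : IsOpen U) (hUs : {z : ℂ | 1 / 2 ≤ z.re ∧ z.re ≤ σ₀} ⊆ U) (S : Finset ℝ) (hS : ∀ c ∈ S, 1 / 2 < c)
    (hs : ∀ a b, DifferentiableOn ℂ (fun z : ℂ => ⟪φ' b, M z (φ a)⟫_ℂ) (U \ ((S.image fun c : ℝ => (c : ℂ)) : Set ℂ)))
    {B : ℝ} (hB : ∀ a b, ∀ z : ℂ, 1 / 2 < z.re → z.re ≤ σ₀ → 1 ≤ |z.im| → ‖⟪φ' b, M z (φ a)⟫_ℂ‖ ≤ B) {σ : ℝ} (hσ₁ : 1 / 2 ≤ σ) (hσ₂ : σ ≤ σ₀) (hσ : ∀ c ∈ S, σ ≠ c) :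
    Integrable fun y : ℝ => ⟪∑ b, mellin (f' b) (-(1 - conj ((σ : ℂ) + y * I))) • φ' b, ∑ a, mellin (f a) (-((σ : ℂ) + y * I)) • φ a⟫_ℂ +
      ⟪∑ b, mellin (f' b) (-conj ((σ : ℂ) + y * I)) • φ' b, M ((σ : ℂ) + y * I) (∑ a, mellin (f a) (-((σ : ℂ) + y * I)) • φ a)⟫_ℂ := by
  have h := integrable_finsetSum Finset.univ fun a (_ : a ∈ Finset.univ) => integrable_finsetSum Finset.univ fun b (_ : b ∈ Finset.univ) =>
    integrable_innerProductIntegrand_const_vertical_of_finset (hf a) (hfs a) (hf0 a) (hf' b) (hf's b) (hf'0 b) hσ₀ hUo hUs (hs a b) hS (hB a b) ⟪φ' b, φ a⟫_ℂ hσ₁ hσ₂ hσ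
  exact h.congr (Eventually.of_forall fun y => (vectorIntegrand_eq_sum_sum f f' φ φ' M _).symm)

/-- **HEAD — THE VECTOR TWO-TERM FORMULA MOVED TO THE UNITARY AXIS ACROSS FINITELY MANY SIMPLE REAL POLES (ON LETTERS).**  Data: a complex inner-product space `V`; finite families of test
functions `f_a, f′_b ∈ C²_c((0,∞))` and vectors `φ_a, φ′_b ∈ V` (the section field `Ψ = Σ_a f_a ⊗ φ_a`, transform `Ψ̂(w) = Σ_a f̃_a(w)•φ_a`); the operator datum `M : ℂ → End V` with ENTRY
LETTERS (★ T4b-multi's, per `(a,b)`): `hs` holomorphy of `z ↦ ⟪φ′_b, M(z)φ_a⟫` on an open `U ⊇ {½ ≤ Re z ≤ σ₀}` off a finset `S ⊂ (½, σ₀)` of real poles, `hr` residues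
`(z − c)·⟪φ′_b, M(z)φ_a⟫ → ⟪φ′_b, R_c φ_a⟫` (`R_c ∈ End V`), `hB` the strip bound at `|Im z| ≥ 1`; and the two-term inner-product identity on the line `Re z = σ₀ > ½`
**(hIP)** `IP = C·((2π)⁻¹·∫_ℝ (⟪Ψ̂′(−(1−z̄)), Ψ̂(−z)⟫ + ⟪Ψ̂′(−z̄), M(z)Ψ̂(−z)⟫) dy)`.  CONCLUSION: **`IP = C·(Σ_{c∈S} ⟪Ψ̂′(−c), R_c Ψ̂(−c)⟫) + C·((2π)⁻¹·∫_ℝ (same at z = ½+iy) dy)`** —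
LITERALLY the `hIP` of ★ `K2E1PseudoEisensteinPlancherelIsometryOperator.plancherelForm_of_innerProductFormula_op` with `(Φ, Ψ, s, D, k) := (Ψ̂, Ψ̂′, M, C·Σ_c ⟪Ψ̂′(−c), R_c Ψ̂(−c)⟫, (2π)⁻¹)`;
its `hG` is `integrable_vectorIntegrand_vertical` at `σ = ½` (after ★ `axis_integrand_eq_op`). [cite: MoeglinWaldspurger1995, II.2.1, II.2.4, IV.1.11] [cite: Titchmarsh1939, §3.12] -/
theorem pseudoEisenstein_contourShift_vector_of_letters {f : α → ℝ → ℂ} {f' : β → ℝ → ℂ}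
    (hf : ∀ a, ContDiff ℝ 2 (f a)) (hfs : ∀ a, HasCompactSupport (f a)) (hf0 : ∀ a, tsupport (f a) ⊆ Ioi 0)
    (hf' : ∀ b, ContDiff ℝ 2 (f' b)) (hf's : ∀ b, HasCompactSupport (f' b)) (hf'0 : ∀ b, tsupport (f' b) ⊆ Ioi 0) {σ₀ : ℝ} (hσ₀ : 1 / 2 < σ₀)
    (φ : α → V) (φ' : β → V) (M : ℂ → V →ₗ[ℂ] V)
    {U : Set ℂ} (hUo : IsOpen U) (hUs : {z : ℂ | 1 / 2 ≤ z.re ∧ z.re ≤ σ₀} ⊆ U) (S : Finset ℝ) (hS : ∀ c ∈ S, 1 / 2 < c ∧ c < σ₀)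
    (hs : ∀ a b, DifferentiableOn ℂ (fun z : ℂ => ⟪φ' b, M z (φ a)⟫_ℂ) (U \ ((S.image fun c : ℝ => (c : ℂ)) : Set ℂ)))
    (R : ℝ → V →ₗ[ℂ] V) (hr : ∀ a b, ∀ c ∈ S, Tendsto (fun z : ℂ => (z - c) * ⟪φ' b, M z (φ a)⟫_ℂ) (𝓝[≠] (c : ℂ)) (𝓝 ⟪φ' b, R c (φ a)⟫_ℂ))
    {B : ℝ} (hB : ∀ a b, ∀ z : ℂ, 1 / 2 < z.re → z.re ≤ σ₀ → 1 ≤ |z.im| → ‖⟪φ' b, M z (φ a)⟫_ℂ‖ ≤ B)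
    {IP C : ℂ} (hIP : IP = C * ((((2 * π)⁻¹ : ℝ) : ℂ) * ∫ y : ℝ,
      (⟪∑ b, mellin (f' b) (-(1 - conj ((σ₀ : ℂ) + y * I))) • φ' b, ∑ a, mellin (f a) (-((σ₀ : ℂ) + y * I)) • φ a⟫_ℂ +
        ⟪∑ b, mellin (f' b) (-conj ((σ₀ : ℂ) + y * I)) • φ' b, M ((σ₀ : ℂ) + y * I) (∑ a, mellin (f a) (-((σ₀ : ℂ) + y * I)) • φ a)⟫_ℂ))) :
    IP = C * (∑ c ∈ S, ⟪∑ b, mellin (f' b) (-(c : ℂ)) • φ' b, R c (∑ a, mellin (f a) (-(c : ℂ)) • φ a)⟫_ℂ) +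
      C * ((((2 * π)⁻¹ : ℝ) : ℂ) * ∫ y : ℝ,
        (⟪∑ b, mellin (f' b) (-(1 - conj ((((1 / 2 : ℝ)) : ℂ) + y * I))) • φ' b, ∑ a, mellin (f a) (-((((1 / 2 : ℝ)) : ℂ) + y * I)) • φ a⟫_ℂ +
          ⟪∑ b, mellin (f' b) (-conj ((((1 / 2 : ℝ)) : ℂ) + y * I)) • φ' b, M ((((1 / 2 : ℝ)) : ℂ) + y * I) (∑ a, mellin (f a) (-((((1 / 2 : ℝ)) : ℂ) + y * I)) • φ a)⟫_ℂ)) := by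
  have hS' : ∀ c ∈ S, 1 / 2 < c := fun c hc => (hS c hc).1
  -- integrability of every entry on the two lines, to swap `∫` and `Σ`
  have hint : ∀ {σ : ℝ}, 1 / 2 ≤ σ → σ ≤ σ₀ → (∀ c ∈ S, σ ≠ c) → ∀ a b, Integrable fun y : ℝ => mellin (f a) (-((σ : ℂ) + y * I)) *
      (⟪φ' b, φ a⟫_ℂ * conj (mellin (f' b) (-(1 - conj ((σ : ℂ) + y * I)))) + ⟪φ' b, M ((σ : ℂ) + y * I) (φ a)⟫_ℂ * conj (mellin (f' b) (-conj ((σ : ℂ) + y * I)))) :=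
    fun hσ₁ hσ₂ hσ a b => integrable_innerProductIntegrand_const_vertical_of_finset (hf a) (hfs a) (hf0 a) (hf' b) (hf's b) (hf'0 b) hσ₀ hUo hUs (hs a b) hS' (hB a b) _ hσ₁ hσ₂ hσ
  have hswap : ∀ {σ : ℝ}, 1 / 2 ≤ σ → σ ≤ σ₀ → (∀ c ∈ S, σ ≠ c) →
      ∫ y : ℝ, (⟪∑ b, mellin (f' b) (-(1 - conj ((σ : ℂ) + y * I))) • φ' b, ∑ a, mellin (f a) (-((σ : ℂ) + y * I)) • φ a⟫_ℂ +
        ⟪∑ b, mellin (f' b) (-conj ((σ : ℂ) + y * I)) • φ' b, M ((σ : ℂ) + y * I) (∑ a, mellin (f a) (-((σ : ℂ) + y * I)) • φ a)⟫_ℂ) =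
      ∑ a, ∑ b, ∫ y : ℝ, mellin (f a) (-((σ : ℂ) + y * I)) *
        (⟪φ' b, φ a⟫_ℂ * conj (mellin (f' b) (-(1 - conj ((σ : ℂ) + y * I)))) + ⟪φ' b, M ((σ : ℂ) + y * I) (φ a)⟫_ℂ * conj (mellin (f' b) (-conj ((σ : ℂ) + y * I)))) := by
    intro σ hσ₁ hσ₂ hσ
    simp_rw [vectorIntegrand_eq_sum_sum]
    rw [integral_finsetSum _ fun a _ => integrable_finsetSum _ fun b _ => hint hσ₁ hσ₂ hσ a b]
    refine Finset.sum_congr rfl fun a _ => ?_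
    rw [integral_finsetSum _ fun b _ => hint hσ₁ hσ₂ hσ a b]
  have hπ : ((((2 * π)⁻¹ : ℝ) : ℂ)) * (2 * π) = 1 := by
    push_cast
    exact inv_mul_cancel₀ (mul_ne_zero two_ne_zero (ofReal_ne_zero.2 Real.pi_pos.ne'))
  rw [hIP, hswap hσ₀.le le_rfl (fun c hc => (hS c hc).2.ne'), hswap le_rfl hσ₀.le (fun c hc => (hS c hc).1.ne),
    sum_sum_integral_innerProductIntegrand_const_eq hf hfs hf0 hf' hf's hf'0 hσ₀ hUo hUs S hS (fun a b => ⟪φ' b, φ a⟫_ℂ) (fun a b z => ⟪φ' b, M z (φ a)⟫_ℂ) hs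
      (fun a b c => ⟪φ' b, R c (φ a)⟫_ℂ) hr hB]
  simp_rw [← vectorResidue_eq_sum_sum]
  rw [mul_add, ← mul_assoc ((((2 * π)⁻¹ : ℝ) : ℂ)) (2 * π), hπ, one_mul, mul_add, add_comm]

end Vector

end Summit.HodgeConjecture.HodgeConjecture.Cruxes.H413.K2E1PseudoEisensteinContourShiftVector

end
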